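import Summits.KontsevichZagierPeriods.KontsevichZagierPeriods.Theses.LiftingCriteria
import Literature.NumberTheory.Transcendental.BakerRelationDecomposition
import Literature.NumberTheory.Transcendental.KZDilationLogGenerators
import Literature.NumberTheory.Transcendental.KZDilationLogSectorLift
import Literature.NumberTheory.Transcendental.SemialgebraicAlgebraicPoints
import Summits.KontsevichZagierPeriods.KontsevichZagierPeriods.Theorems.LiftingCriteriaDilationLiftAtOneSingleGenerator
import Summits.KontsevichZagierPeriods.KontsevichZagierPeriods.Theorems.LiftingCriteriaDilationLiftAtOneTwistedDiagonal

/-!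
# `DilationLiftAtOne` holds on the real Baker sector (crux stmt-KontsevichZagierPeriods-3571,
route LiftingCriteria, line `registered`, registered stub `stub_bakerSectorReal`)

**Theorem (unconditional).** Let `ρ` be Nash (`ℚ`-semialgebraic and real-analytic) on an open
interval `(a, b) ⊇ [0,1]`, and let `α_k, c_k` be real algebraic numbers with `α_k ∉ (a, b)`. Put
`g(x) := ρ'(x) + Σ_k c_k/(x − α_k)` — the general one-variable Nash integrand whose abelian
integral is LOGARITHMIC WITH REAL DATA (genus `0`, real poles). If the cube period vanishes,
`∫₀¹ g = 0`, then the dilation function `v_g(ϖ) = ∫_{[0,1]¹} g(ϖ z) dz` factors on ALL of `[0,1]` as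
`(ϖ − 1)·∫_{[0,1]¹} K(ϖ, ϖy) dy` with ONE kernel `K` Nash on an open `V ⊇ [0,1] × [0,1]` — the
conclusion of the glue stub / of the crux `DilationLiftAtOne` for this `g` (dimension one).

Proof. `∫₀¹ g = (ρ(1) − ρ(0)) + Σ_k c_k log(1 − 1/α_k)` is a vanishing linear form with real
algebraic coefficients in `1` and real logarithms of positive algebraic numbers. By BAKER'S THEOREM
(`Literature.NumberTheory.Transcendental.baker_real_coeff`, sorry-free in the tree, in the form
`baker_decomposition`): `ρ(1) = ρ(0)`, and `c_k = Σ_j c_j N_{jk}` for RATIONAL exact relations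
`Σ_k N_{jk} log(1 − 1/α_k) = 0`. Hence `Σ_k c_k/(x − α_k) = Σ_j c_j · Q_j'/Q_j` as functions, with
`Q_j := Π_k (1 − x/α_k)^{N_{jk}}` Nash, positive and `Q_j(1) = Q_j(0) = 1`
(`KZDilationLogGenerators.lean`) — each `Q_j'/Q_j` is in the logarithmic sector, lifted by the tree
theorem `KZ.dilationLogSector_lift` (division trick, no arithmetic); and `v_{ρ'} = dslope ρ 0`
vanishes at `1`, so it is `(ϖ − 1)·(Nash)`. Summing the kernels gives `K`. This is the
`𝔾ₐ × 𝔾ₘ^A`-instance of the dimension-one lifting mechanism (analytic subgroup theorem ⇒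
null-homotopic Nash loop ⇒ twisted kernel): Baker's theorem IS the analytic subgroup theorem for
`𝔾ₐ × 𝔾ₘ^A`. Not covered here (next sector): complex poles (arctangent part, unimodular loops).
-/

noncomputable section

open Set MeasureTheory Filter MvPolynomial
open scoped BigOperators Topology
open Literature.ModelTheory.ExponentialFields
open Literature.NumberTheory.Transcendental

namespace Summit.KontsevichZagierPeriods.LiftingCriteria.DilationLiftAtOne

/-! ### Two bookkeeping lemmas -/

/-- A twisted kernel `y ↦ K(vecCons ϖ (ϖ • y))` is integrable on `[0,1]¹` when `K` is analytic on
`V ∋ vecCons ϖ x` (`x ∈ [0,1]¹`). [folklore] -/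
theorem integrableOn_twist_one {K : (Fin 2 → ℝ) → ℝ} {V : Set (Fin 2 → ℝ)}
    (hVc : ∀ ϖ ∈ Icc (0:ℝ) 1, ∀ x ∈ Set.pi Set.univ (fun _ : Fin 1 => Icc (0:ℝ) 1),
      Matrix.vecCons ϖ x ∈ V)
    (hKa : AnalyticOnNhd ℝ K V) {ϖ : ℝ} (hϖ : ϖ ∈ Icc (0:ℝ) 1) :
    IntegrableOn (fun y : Fin 1 → ℝ => K (Matrix.vecCons ϖ (ϖ • y)))
      (Set.pi Set.univ (fun _ : Fin 1 => Icc (0:ℝ) 1)) volume := by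
  refine ContinuousOn.integrableOn_compact (isCompact_cube 1) ?_
  have hpath : Continuous fun y : Fin 1 → ℝ => Matrix.vecCons ϖ (ϖ • y) :=
    continuous_const.matrixVecCons (continuous_const_smul ϖ)
  exact hKa.continuousOn.comp hpath.continuousOn fun y hy => hVc ϖ hϖ _ (smul_mem_unitCube hϖ hy)

/-- Finite intersections of `ℚ`-semialgebraic sets are semialgebraic. [cite: BochnakCosteRoy1998, §2.1] -/
theorem isSemialgebraic_iInter_fin {m n : ℕ} {V : Fin n → Set (Fin m → ℝ)}
    (h : ∀ j, IsSemialgebraic ℚ (V j)) : IsSemialgebraic ℚ (⋂ j, V j) := by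
  classical
  have key : ∀ s : Finset (Fin n), IsSemialgebraic ℚ (⋂ j ∈ s, V j) := by
    intro s
    induction s using Finset.induction_on with
    | empty => simp
    | insert a s ha ih =>
      rw [Finset.set_biInter_insert]
      exact (h a).inter ih
  simpa using key Finset.univ

/-! ### The real Baker sector of the glue -/

/-- **`DilationLiftAtOne` on the real Baker sector (single generator, dimension one) —
unconditional.** See the module docstring: for `ρ` Nash on `(a,b) ⊇ [0,1]`, real algebraic poles
`α_k ∉ (a,b)` and residues `c_k`, and `g = ρ' + Σ_k c_k/(x − α_k)` with `∫₀¹ g = 0`, the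
dilation function `v_g` lies in `(ϖ − 1)·D'` with one twisted Nash kernel on a neighbourhood of
`[0,1] × [0,1]`. Inputs: Baker's theorem (`baker_real_coeff`, proved in the tree) through
`baker_decomposition`, and the logarithmic-sector lift `KZ.dilationLogSector_lift`.
[cite: Baker1975, Theorem 2.1] -/
theorem bakerSectorReal_lift {a b : ℝ} (ha : a < 0) (hb : 1 < b) {ρ : ℝ → ℝ}
    (hρs : IsSemialgebraicFunOn ℚ {t : Fin 1 → ℝ | t 0 ∈ Ioo a b} (fun t => ρ (t 0)))
    (hρa : ∀ x ∈ Ioo a b, AnalyticAt ℝ ρ x)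
    {A : ℕ} {α c : Fin A → ℝ} (hαalg : ∀ k, IsAlgebraic ℚ (α k))
    (hcalg : ∀ k, IsAlgebraic ℚ (c k)) (hα : ∀ k, α k ≤ a ∨ b ≤ α k)
    (hsum : (∫ z in Set.pi Set.univ (fun _ : Fin 1 => Icc (0:ℝ) 1),
      (deriv ρ (((1:ℝ) • z) 0) + ∑ k, c k / (((1:ℝ) • z) 0 - α k))) = 0) :
    ∃ (K : (Fin 2 → ℝ) → ℝ) (V : Set (Fin 2 → ℝ)), IsOpen V ∧
      (∀ ϖ ∈ Icc (0:ℝ) 1, ∀ x ∈ Set.pi Set.univ (fun _ : Fin 1 => Icc (0:ℝ) 1),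
        Matrix.vecCons ϖ x ∈ V) ∧
      IsSemialgebraicFunOn ℚ V K ∧ AnalyticOnNhd ℝ K V ∧
      ∀ ϖ ∈ Icc (0:ℝ) 1,
        (∫ z in Set.pi Set.univ (fun _ : Fin 1 => Icc (0:ℝ) 1),
            (deriv ρ ((ϖ • z) 0) + ∑ k, c k / ((ϖ • z) 0 - α k))) =
          (ϖ - 1) * ∫ y in Set.pi Set.univ (fun _ : Fin 1 => Icc (0:ℝ) 1),
            K (Matrix.vecCons ϖ (ϖ • y)) := by
  classical
  have hb0 : (0:ℝ) < b := zero_lt_one.trans hb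
  have h0I : (0:ℝ) ∈ Ioo a b := ⟨ha, hb0⟩
  have h1I : (1:ℝ) ∈ Ioo a b := ⟨ha.trans zero_lt_one, hb⟩
  have hsub : Icc (0:ℝ) 1 ⊆ Ioo a b := fun x hx => ⟨ha.trans_le hx.1, hx.2.trans_lt hb⟩
  have hI : IsSemialgebraic ℚ {t : Fin 1 → ℝ | t 0 ∈ Ioo a b} :=
    IsSemialgebraicFunOn.isSemialgebraic_holds hρs
  -- derivatives and continuity of the data
  have hρd : ∀ x ∈ Ioo a b, HasDerivAt ρ (deriv ρ x) x := fun x hx =>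
    (hρa x hx).differentiableAt.hasDerivAt
  have hρ'c : ContinuousOn (deriv ρ) (Ioo a b) := fun x hx =>
    (hρa x hx).deriv.continuousAt.continuousWithinAt
  -- the polar part `σ = Σ_k c_k/(x − α_k)` and its primitive `Λ = Σ_k c_k log(1 − x/α_k)`
  set σ : ℝ → ℝ := fun x => ∑ k, c k / (x - α k) with hσ_def
  set Λ : ℝ → ℝ := fun x => ∑ k, c k * Real.log (1 - x / α k) with hΛ_def
  have hΛd : ∀ x ∈ Ioo a b, HasDerivAt Λ (σ x) x := by
    intro x hx
    have h := HasDerivAt.fun_sum (u := Finset.univ)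
      fun k _ => (KZ.DilationLogSector.hasDerivAt_log_one_sub_div ha hb0 hα k hx).const_mul (c k)
    have hσx : σ x = ∑ k, c k * (1 / (x - α k)) :=
      Finset.sum_congr rfl fun k _ => by rw [mul_one_div]
    rw [hσx]
    exact h
  have hpole : ∀ k, ∀ x ∈ Ioo a b, x - α k ≠ 0 := by
    intro k x hx h
    rw [sub_eq_zero] at h
    rcases hα k with h' | h'
    · exact absurd (h ▸ hx.1) (not_lt.mpr h')
    · exact absurd (h ▸ hx.2) (not_lt.mpr h')
  have hσc : ContinuousOn σ (Ioo a b) := by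
    refine continuousOn_finsetSum _ fun k _ => ?_
    exact continuousOn_const.div (continuousOn_id.sub continuousOn_const) (hpole k)
  -- the numerical relation at `ϖ = 1`: `(ρ 1 − ρ 0) + Σ_k c_k log(1 − 1/α_k) = 0`
  have hnum : (ρ 1 - ρ 0) + ∑ k, c k * Real.log (1 - 1 / α k) = 0 := by
    have hone : (1:ℝ) ∈ Ioc (0:ℝ) 1 := ⟨zero_lt_one, le_rfl⟩
    have hi1 : IntegrableOn (fun z : Fin 1 → ℝ => deriv ρ (((1:ℝ) • z) 0))
        (Set.pi Set.univ (fun _ : Fin 1 => Icc (0:ℝ) 1)) volume :=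
      KZ.DilationLogSector.integrableOn_dilate_one ha hb hρ'c ⟨zero_le_one, le_rfl⟩
    have hi2 : IntegrableOn (fun z : Fin 1 → ℝ => σ (((1:ℝ) • z) 0))
        (Set.pi Set.univ (fun _ : Fin 1 => Icc (0:ℝ) 1)) volume :=
      KZ.DilationLogSector.integrableOn_dilate_one ha hb hσc ⟨zero_le_one, le_rfl⟩
    have hsplit := integral_add hi1 hi2
    have hA : (∫ z in Set.pi Set.univ (fun _ : Fin 1 => Icc (0:ℝ) 1), deriv ρ (((1:ℝ) • z) 0)) =
        ρ 1 - ρ 0 := by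
      rw [KZ.DilationLogSector.dilation_integral_deriv ha hb hρa ⟨zero_le_one, le_rfl⟩, dslope_of_ne _ one_ne_zero,
        slope_def_field]
      simp
    have hB : (∫ z in Set.pi Set.univ (fun _ : Fin 1 => Icc (0:ℝ) 1), σ (((1:ℝ) • z) 0)) =
        ∑ k, c k * Real.log (1 - 1 / α k) := by
      rw [KZ.DilationLogSector.dilation_integral_of_hasDerivAt ha hb hΛd hσc hone]
      simp [hΛ_def]
    rw [← hA, ← hB, ← hsplit]
    simpa only [hσ_def] using hsum
  -- BAKER: `ρ 1 = ρ 0` and `c = Σ_j c_j N_j` with rational exact relations `N_j`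
  have hℓalg : ∀ k, IsAlgebraic ℚ (Real.exp (Real.log (1 - 1 / α k))) := fun k => by
    rw [Real.exp_log (KZ.DilationLogSector.one_sub_div_pos ha hb0 hα k h1I), one_div]
    exact isAlgebraic_one.sub (hαalg k).inv
  have hralg : IsAlgebraic ℚ (ρ 1 - ρ 0) :=
    (hρs.isAlgebraic_apply_one h1I isAlgebraic_one).sub (hρs.isAlgebraic_apply_one h0I isAlgebraic_zero)
  obtain ⟨hr0, N, hN1, hN2⟩ :=
    baker_decomposition (fun k => Real.log (1 - 1 / α k)) hℓalg hralg hcalg hnum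
  -- the logarithmic generators `Q_j = Π_k (1 − x/α_k)^{N_{jk}}`, `h_j = Q_j'/Q_j = Σ_k N_{jk}/(x − α_k)`,
  -- and their lifts (logarithmic sector, division trick)
  set hgen : Fin A → ℝ → ℝ := fun j x => ∑ k, (N j k : ℝ) / (x - α k) with hh_def
  have hlift : ∀ j, ∃ (K : (Fin 2 → ℝ) → ℝ) (V : Set (Fin 2 → ℝ)), IsOpen V ∧
      (∀ ϖ ∈ Icc (0:ℝ) 1, ∀ x ∈ Set.pi Set.univ (fun _ : Fin 1 => Icc (0:ℝ) 1),
        Matrix.vecCons ϖ x ∈ V) ∧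
      IsSemialgebraicFunOn ℚ V K ∧ AnalyticOnNhd ℝ K V ∧
      ∀ ϖ ∈ Icc (0:ℝ) 1,
        (∫ z in Set.pi Set.univ (fun _ : Fin 1 => Icc (0:ℝ) 1), hgen j ((ϖ • z) 0)) =
          (ϖ - 1) * ∫ y in Set.pi Set.univ (fun _ : Fin 1 => Icc (0:ℝ) 1),
            K (Matrix.vecCons ϖ (ϖ • y)) := fun j =>
    KZ.dilationLogSector_lift ha hb (KZ.DilationLogSector.isSemialgebraicFunOn_prod_rpow ha hb0 hα hαalg hI (N j))
      (fun x hx => KZ.DilationLogSector.analyticAt_prod_rpow ha hb0 hα (N j) hx) (fun x hx => KZ.DilationLogSector.prod_rpow_pos ha hb0 hα (N j) hx)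
      (fun x hx => KZ.DilationLogSector.hasDerivAt_prod_rpow ha hb0 hα (N j) hx)
      (by rw [KZ.DilationLogSector.prod_rpow_one ha hb hα (N j) (hN1 j), KZ.DilationLogSector.prod_rpow_zero])
  choose K V hVo hVc hKs hKa hKid using hlift
  have hgenc : ∀ j, ContinuousOn (hgen j) (Ioo a b) := fun j => by
    refine continuousOn_finsetSum _ fun k _ => ?_
    exact continuousOn_const.div (continuousOn_id.sub continuousOn_const) (hpole k)
  -- the exact part: `v_{ρ'} = dslope ρ 0 = (ϖ − 1) τ`, `τ = dslope (dslope ρ 0) 1` Nash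
  set τ : ℝ → ℝ := dslope (dslope ρ 0) 1 with hτ_def
  have hds1 : dslope ρ 0 1 = 0 := by
    rw [dslope_of_ne _ one_ne_zero, slope_def_field, sub_zero, div_one]
    exact hr0
  have hτeq : ∀ ϖ, dslope ρ 0 ϖ = (ϖ - 1) * τ ϖ := fun ϖ => by
    have h := sub_smul_dslope (dslope ρ 0) 1 ϖ
    rw [hds1, sub_zero, smul_eq_mul] at h
    exact h.symm
  have hσ0s : IsSemialgebraicFunOn ℚ {t : Fin 1 → ℝ | t 0 ∈ Ioo a b} (fun t => dslope ρ 0 (t 0)) := by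
    have h := IsSemialgebraicFunOn.dslope_ratCast (f' := deriv ρ) 0 (by simpa using h0I) hρs hρd
    simpa using h
  have hσ0a : ∀ x ∈ Ioo a b, AnalyticAt ℝ (dslope ρ 0) x := fun x hx =>
    analyticAt_dslope_of_analyticAt (hρa 0 h0I) (hρa x hx)
  have hτs : IsSemialgebraicFunOn ℚ {t : Fin 1 → ℝ | t 0 ∈ Ioo a b} (fun t => τ (t 0)) := by
    have h := IsSemialgebraicFunOn.dslope_ratCast (f' := deriv (dslope ρ 0)) 1 (by simpa using h1I)
      hσ0s (fun x hx => (hσ0a x hx).differentiableAt.hasDerivAt)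
    simpa using h
  have hτa : ∀ x ∈ Ioo a b, AnalyticAt ℝ τ x := fun x hx =>
    analyticAt_dslope_of_analyticAt (hσ0a 1 h1I) (hσ0a x hx)
  -- the total kernel and its domain
  set Vt : Set (Fin 2 → ℝ) := {p | p 0 ∈ Ioo a b} ∩ ⋂ j, V j with hVt_def
  set Kt : (Fin 2 → ℝ) → ℝ := fun p => τ (p 0) + ∑ j, c j * K j p with hKt_def
  have hVtI : IsSemialgebraic ℚ {p : Fin 2 → ℝ | p 0 ∈ Ioo a b} := by
    simpa using hI.preimage_comp (fun _ : Fin 1 => (0 : Fin 2))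
  have hVts : IsSemialgebraic ℚ Vt :=
    hVtI.inter (isSemialgebraic_iInter_fin fun j => IsSemialgebraicFunOn.isSemialgebraic_holds (hKs j))
  have hVtsub : ∀ j, Vt ⊆ V j := fun j p hp => mem_iInter.mp hp.2 j
  refine ⟨Kt, Vt, ?_, ?_, ?_, ?_, ?_⟩
  · -- open
    exact (isOpen_Ioo.preimage (continuous_apply 0)).inter (isOpen_iInter_of_finite fun j => hVo j)
  · -- contains `[0,1] × [0,1]`
    intro ϖ hϖ x hx
    exact ⟨by simpa using hsub hϖ, mem_iInter.mpr fun j => hVc j ϖ hϖ x hx⟩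
  · -- semialgebraic
    have hproj : IsSemialgebraicMapOn ℚ Vt (fun p : Fin 2 → ℝ => fun _ : Fin 1 => p 0) :=
      IsSemialgebraicMapOn.of_forall hVts fun _ => by
        simpa using isSemialgebraicFunOn_aeval hVts (X 0 : MvPolynomial (Fin 2) ℚ)
    have hmaps : MapsTo (fun p : Fin 2 → ℝ => fun _ : Fin 1 => p 0) Vt
        {t : Fin 1 → ℝ | t 0 ∈ Ioo a b} := fun p hp => hp.1
    have hτV : IsSemialgebraicFunOn ℚ Vt (fun p => τ (p 0)) :=
      (IsSemialgebraicFunOn.comp_isSemialgebraicMapOn_holds hτs hproj hmaps).congr fun _ _ => rfl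
    have hsumV : IsSemialgebraicFunOn ℚ Vt (fun p => ∑ j, c j * K j p) :=
      IsSemialgebraicFunOn.fun_finsetSum Finset.univ hVts fun j _ =>
        (isSemialgebraicFunOn_const_of_isAlgebraic hVts (hcalg j)).fun_mul
          ((hKs j).mono (hVtsub j) hVts)
    exact hτV.fun_add hsumV
  · -- analytic
    intro p hp
    have h0 : AnalyticAt ℝ (fun p : Fin 2 → ℝ => p 0) p :=
      (ContinuousLinearMap.proj (R := ℝ) (φ := fun _ : Fin 2 => ℝ) 0).analyticAt p
    have hτp : AnalyticAt ℝ (fun p : Fin 2 → ℝ => τ (p 0)) p :=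
      AnalyticAt.comp (f := fun q : Fin 2 → ℝ => q 0) (hτa (p 0) hp.1) h0
    refine hτp.add ?_
    exact Finset.analyticAt_fun_sum _ fun j _ => analyticAt_const.mul (hKa j p (hVtsub j hp))
  · -- the identity on `[0,1]`
    intro ϖ hϖ
    -- polar part rewritten through the generators: `σ = Σ_j c_j h_j`
    have hσeq : ∀ x, σ x = ∑ j, c j * hgen j x := fun x => by
      simp only [hσ_def, hh_def]
      calc ∑ k, c k / (x - α k) = ∑ k, (∑ j, c j * (N j k : ℝ)) / (x - α k) :=
            Finset.sum_congr rfl fun k _ => by rw [← hN2 k]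
        _ = ∑ k, ∑ j, c j * (N j k : ℝ) / (x - α k) :=
            Finset.sum_congr rfl fun k _ => by rw [Finset.sum_div]
        _ = ∑ j, ∑ k, c j * (N j k : ℝ) / (x - α k) := Finset.sum_comm
        _ = ∑ j, c j * ∑ k, (N j k : ℝ) / (x - α k) :=
            Finset.sum_congr rfl fun j _ => by
              rw [Finset.mul_sum]
              exact Finset.sum_congr rfl fun k _ => by ring
    -- left-hand side
    have hi1 : IntegrableOn (fun z : Fin 1 → ℝ => deriv ρ ((ϖ • z) 0))
        (Set.pi Set.univ (fun _ : Fin 1 => Icc (0:ℝ) 1)) volume :=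
      KZ.DilationLogSector.integrableOn_dilate_one ha hb hρ'c hϖ
    have hij : ∀ j, IntegrableOn (fun z : Fin 1 → ℝ => c j * hgen j ((ϖ • z) 0))
        (Set.pi Set.univ (fun _ : Fin 1 => Icc (0:ℝ) 1)) volume := fun j =>
      (KZ.DilationLogSector.integrableOn_dilate_one ha hb (hgenc j) hϖ).const_mul (c j)
    have hi2 : IntegrableOn (fun z : Fin 1 → ℝ => ∑ j, c j * hgen j ((ϖ • z) 0))
        (Set.pi Set.univ (fun _ : Fin 1 => Icc (0:ℝ) 1)) volume :=
      integrable_finsetSum _ fun j _ => hij j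
    have hL : (∫ z in Set.pi Set.univ (fun _ : Fin 1 => Icc (0:ℝ) 1),
          (deriv ρ ((ϖ • z) 0) + ∑ k, c k / ((ϖ • z) 0 - α k))) =
        (ϖ - 1) * τ ϖ + ∑ j, c j * ((ϖ - 1) *
          ∫ y in Set.pi Set.univ (fun _ : Fin 1 => Icc (0:ℝ) 1), K j (Matrix.vecCons ϖ (ϖ • y))) := by
      have hfun : (fun z : Fin 1 → ℝ => deriv ρ ((ϖ • z) 0) + ∑ k, c k / ((ϖ • z) 0 - α k)) =
          fun z => deriv ρ ((ϖ • z) 0) + ∑ j, c j * hgen j ((ϖ • z) 0) := by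
        funext z
        have := hσeq ((ϖ • z) 0)
        simp only [hσ_def] at this
        rw [this]
      rw [hfun, integral_add hi1 hi2, integral_finsetSum _ fun j _ => hij j,
        KZ.DilationLogSector.dilation_integral_deriv ha hb hρa hϖ, hτeq]
      congr 1
      exact Finset.sum_congr rfl fun j _ => by rw [integral_const_mul, hKid j ϖ hϖ]
    -- right-hand side
    have hk0 : ∀ y : Fin 1 → ℝ, (Matrix.vecCons ϖ (ϖ • y) : Fin 2 → ℝ) 0 = ϖ := fun y => by simp
    have hkj : ∀ j, IntegrableOn (fun y : Fin 1 → ℝ => c j * K j (Matrix.vecCons ϖ (ϖ • y)))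
        (Set.pi Set.univ (fun _ : Fin 1 => Icc (0:ℝ) 1)) volume := fun j =>
      (integrableOn_twist_one (hVc j) (hKa j) hϖ).const_mul (c j)
    have hk1 : IntegrableOn (fun y : Fin 1 → ℝ => τ ((Matrix.vecCons ϖ (ϖ • y) : Fin 2 → ℝ) 0))
        (Set.pi Set.univ (fun _ : Fin 1 => Icc (0:ℝ) 1)) volume := by
      simp only [hk0]
      exact integrableOn_const (hs := by
        rw [volume_cube]; exact ENNReal.one_ne_top) 
    have hk2 : IntegrableOn (fun y : Fin 1 → ℝ => ∑ j, c j * K j (Matrix.vecCons ϖ (ϖ • y)))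
        (Set.pi Set.univ (fun _ : Fin 1 => Icc (0:ℝ) 1)) volume :=
      integrable_finsetSum _ fun j _ => hkj j
    have hR : (∫ y in Set.pi Set.univ (fun _ : Fin 1 => Icc (0:ℝ) 1), Kt (Matrix.vecCons ϖ (ϖ • y))) =
        τ ϖ + ∑ j, c j *
          ∫ y in Set.pi Set.univ (fun _ : Fin 1 => Icc (0:ℝ) 1), K j (Matrix.vecCons ϖ (ϖ • y)) := by
      simp only [hKt_def]
      rw [integral_add hk1 hk2, integral_finsetSum _ fun j _ => hkj j]
      simp only [hk0, KZ.DilationLogSector.setIntegral_cube_one_const]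
      congr 1
      exact Finset.sum_congr rfl fun j _ => by rw [integral_const_mul]
    rw [hL, hR, mul_add, Finset.mul_sum]
    congr 1
    exact Finset.sum_congr rfl fun j _ => by ring

/-- **Stub `stub_bakerSectorReal` of the registered skeleton of crux stmt-KontsevichZagierPeriods-3571
(line `registered`, reshaped by lead c2): the real Baker sector of the glue holds unconditionally.**
Verbatim the registered signature; proof = `bakerSectorReal_lift`.
[cite: Baker1975, Theorem 2.1] -/
theorem stub_bakerSectorReal :
    ∀ (a b : ℝ), a < 0 → 1 < b → ∀ (ρ : ℝ → ℝ), Literature.NumberTheory.Transcendental.IsSemialgebraicFunOn ℚ {t : Fin 1 → ℝ | t 0 ∈ Set.Ioo a b} (fun t => ρ (t 0)) → (∀ x ∈ Set.Ioo a b, AnalyticAt ℝ ρ x) → ∀ (A : ℕ) (α c : Fin A → ℝ), (∀ k, IsAlgebraic ℚ (α k)) → (∀ k, IsAlgebraic ℚ (c k)) → (∀ k, α k ≤ a ∨ b ≤ α k) → (∫ z in Set.pi Set.univ (fun _ : Fin 1 => Set.Icc (0:ℝ) 1), (deriv ρ (((1:ℝ) • z) 0) + ∑ k, c k / (((1:ℝ)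 • z) 0 - α k))) = 0 → ∃ (K : (Fin 2 → ℝ) → ℝ) (V : Set (Fin 2 → ℝ)), IsOpen V ∧ (∀ ϖ ∈ Set.Icc (0:ℝ) 1, ∀ x ∈ Set.pi Set.univ (fun _ : Fin 1 => Set.Icc (0:ℝ) 1), Matrix.vecCons ϖ x ∈ V) ∧ Literature.NumberTheory.Transcendental.IsSemialgebraicFunOn ℚ V K ∧ AnalyticOnNhd ℝ K V ∧ ∀ ϖ ∈ Set.Icc (0:ℝ) 1, (∫ z in Set.pi Set.univ (fun _ : Fin 1 => Set.Icc (0:ℝ) 1), (deriv ρ ((ϖ • z) 0) + ∑ k, c k / ((ϖ • z) 0 - α k))) = (ϖ - 1) * ∫ y in Set.pi Set.univ (fun _ : Fin 1 => Set.Icc (0:ℝ) 1), K (Matrix.vecCons ϖ (ϖ • y)) :=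
  fun _ _ ha hb _ hρs hρa _ _ _ hαalg hcalg hα hsum =>
    bakerSectorReal_lift ha hb hρs hρa hαalg hcalg hα hsum

end Summit.KontsevichZagierPeriods.LiftingCriteria.DilationLiftAtOne
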